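import Summits.Ventures.CertifiedArithmetic.LowPrec.SRLimitedBitsOptimal
import Summits.Ventures.CertifiedArithmetic.LowPrec.SRPythagorasWholeRangeGeneric
import HarnessLib

/-!
# Stochastic rounding in low-precision formats, CII: the EXACT BINOMIAL LAW of a constant-increment
# run inside a uniform binade segment, under any `N`-bit rule — mean, bias and mean-square error exactly

HONEST FRAMING: certified error envelopes and provably optimal rounding/accumulation schemes for
low-precision formats under stated cost models; every table by two implementations; no hardware or
vendor claims.

Setting (files I–III of the limited-randomness sub-slice, `SRLimitedBitsCounts` / `SRLimitedBits` /
`SRLimitedBitsOptimal`): recursive accumulation `accExpQ F q x n f s` of increments into a finite number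
system `F` under a perturbed-probability rule `q` (exact SR: `q = id`; IEEE P3109 `StochasticA/B/C` with
`N` random bits: `q = probAwayA/B/C N`).  File III proved STAGNATION: accumulating a constant `δ` from a
member `a` of a gap `[a, b]` with `q(δ/(b − a)) = 0` never moves.  This file is the general exact law of
which stagnation is the case `p = 0`:

* `UniformSeg F g ε M`: the `M + 1` points `g + iε` (`i ≤ M`) are members of `F` and consecutive — a
  binade of a binary format is such a segment (`Formats.valueSet_binade_uniformSeg`: binade `j` of
  `valueSet φ`, `g = 2^(manBits+j)·q`, `ε = 2^j·q`, `M = 2^manBits`, for `j + 2 ≤ emaxCode`).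
* **`accExpQ_const_binomial` (the law).** For a nonnegative segment, a constant increment
  `h = (a + θ)ε` with `a ∈ ℕ`, `0 < θ < 1`, a start `g + iε` and a run length `L` with
  `i + L(a + 1) ≤ M` (the run cannot leave the segment): for EVERY test function `f`,
  `E f(ŝ_L) = E f(g + (i + L·a + B)ε)` with `B ∼ Binomial(L, q θ)` (`binomExp`, first-step recursion).
  The residual `θ` is the same at every step (the step `h` moves a grid point to a point with residual
  `θ` in a cell of the same width), so the `L` roundings are i.i.d. Bernoulli(`q θ`) up-moves.
* **Exact mean, bias, MSE** (`const_run_mean`, `const_run_bias`, `const_run_mse`): with `p = q θ`,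
  `E ŝ_L = s + L(a + p)ε`, bias `−L(θ − p)ε` (LINEAR in `L`), `E(ŝ_L − (s + Lh))² = L·p(1−p)·ε² +
  (L(θ−p)ε)²` (variance linear, squared bias QUADRATIC).  Exact SR (`p = θ`): unbiased, MSE `Lθ(1−θ)ε²`
  (`const_run_exactSR`).  StochasticA, `N` bits (`p = ⌊2^Nθ⌋/2^N`): bias `≤ 0`, `|bias| < L·2^{-N}ε`
  (`const_run_stochasticA`, `Formats.valueSet_const_run_stochasticA`); the squared bias dominates the
  variance once `L > p(1−p)/(θ−p)²` — the coherent worst case of the per-operation bias `u_{p+r}` of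
  [ElararEtAl2025, Lemma 3.3], and the exact form of the constant-`θ` observation of [ArarEtAl2022, §3].
* Kernel instance (E2M1, binade `[1, 2]`, `ε = 1/2`, increment `3/8`, two steps, ONE random bit):
  bias `−1/4`, MSE `3/16` (`Formats.e2m1_const_run_one_bit`), by the general theorem.

Hypotheses stated exactly: the segment is nonnegative (`0 ≤ g`; the rules act on the away-from-zero
probability), uniform (no binade crossing inside the run), inside the format (no saturation);
`0 < θ < 1`.  Mixed-sign and binade-crossing runs are NOT covered (files XXIV/XXVI: crossing counter
chains).  Certificate `certs/sr/gen17/construn/`: DP over the outcome tree vs the closed binomial form.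
-/

namespace Summit.Ventures.CertifiedArithmetic.LowPrec.SR.LimitedBits

open Literature.ComputerArithmetic.ConnollyHighamMary2021
open Summit.Ventures.CertifiedArithmetic.LowPrec.SR
open Finset

section Generic

variable {K : Type*} [Field K] [LinearOrder K] [IsStrictOrderedRing K]

/-! ### The binomial expectation functional -/
/-- `E g(B)` for `B ∼ Binomial(L, p)`, by the first-step recursion
`E g(B_{L+1}) = (1 − p)·E g(B_L) + p·E g(B_L + 1)`. -/
def binomExp (p : K) : ℕ → (ℕ → K) → K
  | 0, g => g 0
  | L + 1, g => (1 - p) * binomExp p L g + p * binomExp p L (fun k => g (k + 1))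

omit [LinearOrder K] [IsStrictOrderedRing K] in
/-- `Binomial(0, p)` is the point mass at `0`. -/
@[simp] theorem binomExp_zero (p : K) (g : ℕ → K) : binomExp p 0 g = g 0 := rfl
omit [LinearOrder K] [IsStrictOrderedRing K] in
/-- The first-step recursion. -/
theorem binomExp_succ (p : K) (L : ℕ) (g : ℕ → K) :
    binomExp p (L + 1) g = (1 - p) * binomExp p L g + p * binomExp p L (fun k => g (k + 1)) := rfl

omit [LinearOrder K] [IsStrictOrderedRing K] in
/-- Constants. -/
theorem binomExp_const (p c : K) : ∀ L : ℕ, binomExp p L (fun _ => c) = c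
  | 0 => rfl
  | L + 1 => by rw [binomExp_succ, binomExp_const p c L]; ring

omit [LinearOrder K] [IsStrictOrderedRing K] in
/-- Additivity. -/
theorem binomExp_add (p : K) : ∀ (L : ℕ) (g h : ℕ → K),
    binomExp p L (fun k => g k + h k) = binomExp p L g + binomExp p L h
  | 0, _, _ => rfl
  | L + 1, g, h => by
    rw [binomExp_succ, binomExp_succ, binomExp_succ, binomExp_add p L g h,
      binomExp_add p L (fun k => g (k + 1)) (fun k => h (k + 1))]
    ring

omit [LinearOrder K] [IsStrictOrderedRing K] in
/-- Homogeneity. -/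
theorem binomExp_mul (p c : K) : ∀ (L : ℕ) (g : ℕ → K),
    binomExp p L (fun k => c * g k) = c * binomExp p L g
  | 0, _ => rfl
  | L + 1, g => by
    rw [binomExp_succ, binomExp_succ, binomExp_mul p c L g, binomExp_mul p c L (fun k => g (k + 1))]
    ring

omit [LinearOrder K] [IsStrictOrderedRing K] in
/-- First moment: `E B = L·p`. -/
theorem binomExp_id (p : K) : ∀ L : ℕ, binomExp p L (fun k => (k : K)) = L * p
  | 0 => by simp
  | L + 1 => by
    have e : (fun k : ℕ => (((k + 1 : ℕ) : K))) = fun k : ℕ => (k : K) + 1 := by funext k; push_cast; ring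
    rw [binomExp_succ, e, binomExp_add, binomExp_id p L, binomExp_const]
    push_cast; ring

omit [LinearOrder K] [IsStrictOrderedRing K] in
/-- Second moment: `E B² = L·p(1 − p) + (L·p)²`. -/
theorem binomExp_sq (p : K) : ∀ L : ℕ,
    binomExp p L (fun k => (k : K) ^ 2) = L * p * (1 - p) + (L * p) ^ 2
  | 0 => by simp
  | L + 1 => by
    have e : (fun k : ℕ => (((k + 1 : ℕ) : K)) ^ 2) = fun k : ℕ => (k : K) ^ 2 + (2 * (k : K) + 1) := by
      funext k; push_cast; ring
    have e2 : binomExp p L (fun k => 2 * (k : K) + 1) = 2 * (L * p) + 1 := by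
      rw [show (fun k : ℕ => 2 * (k : K) + 1) = fun k : ℕ => 2 * (k : K) + (fun _ : ℕ => (1 : K)) k from rfl,
        binomExp_add, binomExp_mul, binomExp_id, binomExp_const]
    rw [binomExp_succ, e, binomExp_add, binomExp_sq p L, e2]
    push_cast; ring

omit [LinearOrder K] [IsStrictOrderedRing K] in
/-- An affine test function: `E (c + B·d) = c + L·p·d`. -/
theorem binomExp_affine (p c d : K) (L : ℕ) :
    binomExp p L (fun k => c + (k : K) * d) = c + L * p * d := by
  have e : (fun k : ℕ => c + (k : K) * d) = fun k : ℕ => (fun _ : ℕ => c) k + d * (k : K) := by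
    funext k; ring
  rw [e, binomExp_add, binomExp_const, binomExp_mul, binomExp_id]; ring

omit [LinearOrder K] [IsStrictOrderedRing K] in
/-- A squared affine test function: `E (B·d − m)² = L p(1−p) d² + (L p d − m)²`. -/
theorem binomExp_sq_affine (p d m : K) (L : ℕ) :
    binomExp p L (fun k => ((k : K) * d - m) ^ 2) = L * p * (1 - p) * d ^ 2 + (L * p * d - m) ^ 2 := by
  have e : (fun k : ℕ => ((k : K) * d - m) ^ 2) =
      fun k : ℕ => d ^ 2 * (k : K) ^ 2 + ((-(2 * d * m)) * (k : K) + (fun _ : ℕ => m ^ 2) k) := by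
    funext k; ring
  rw [e, binomExp_add, binomExp_add, binomExp_mul, binomExp_mul, binomExp_sq, binomExp_id,
    binomExp_const]
  ring

/-! ### Uniform grid segments -/
/-- A UNIFORM GRID SEGMENT of `F`: the points `g + iε`, `i ≤ M`, are members, and consecutive ones are
neighbours in `F` (nothing of `F` strictly between them). -/
structure UniformSeg (F : Finset K) (g ε : K) (M : ℕ) : Prop where
  mem : ∀ i : ℕ, i ≤ M → g + (i : K) * ε ∈ F
  gap : ∀ i : ℕ, i < M → ∀ y ∈ F, y ≤ g + (i : K) * ε ∨ g + ((i + 1 : ℕ) : K) * ε ≤ y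

/-- One step of the run: from the grid point `g + iε` the increment `(a + θ)ε` lands strictly inside the
cell `[g + (i+a)ε, g + (i+a+1)ε]`, with candidates its endpoints and exact up-probability `θ`. -/
theorem const_step_cell {F : Finset K} {g ε θ : K} {M : ℕ} (hS : UniformSeg F g ε M) (hε : 0 < ε)
    (hθ0 : 0 < θ) (hθ1 : θ < 1) {i a : ℕ} (hia : i + a < M) :
    dn F (g + (i : K) * ε + ((a : K) + θ) * ε) = g + ((i + a : ℕ) : K) * ε ∧
      up F (g + (i : K) * ε + ((a : K) + θ) * ε) = g + ((i + a + 1 : ℕ) : K) * ε ∧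
      pUp F (g + (i : K) * ε + ((a : K) + θ) * ε) = θ := by
  have hlo : g + ((i + a : ℕ) : K) * ε < g + (i : K) * ε + ((a : K) + θ) * ε := by
    have := mul_pos hθ0 hε; push_cast; linarith
  have hhi : g + (i : K) * ε + ((a : K) + θ) * ε < g + ((i + a + 1 : ℕ) : K) * ε := by
    have := mul_lt_mul_of_pos_right hθ1 hε; push_cast; linarith
  obtain ⟨-, hd, hu, hp⟩ :=
    candidates_of_gap (hS.mem (i + a) hia.le) (hS.mem (i + a + 1) hia) (hS.gap (i + a) hia) hlo hhi
  refine ⟨hd, hu, ?_⟩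
  rw [hp, div_eq_iff (by push_cast; linarith)]
  push_cast; ring

/-- **THE BINOMIAL LAW OF A CONSTANT-INCREMENT RUN.** On a nonnegative uniform segment, accumulating the
constant `(a + θ)ε` (`0 < θ < 1`) for `L` steps from `g + iε` with `i + L(a+1) ≤ M` has, under ANY
perturbed-probability rule `q`, exactly the law of `g + (i + L·a + B)ε`, `B ∼ Binomial(L, q θ)`:
`E f(ŝ_L) = binomExp (q θ) L (k ↦ f(g + (i + L a + k)ε))` for every `f`. -/
theorem accExpQ_const_binomial {F : Finset K} (q : K → K) {g ε θ : K} {M : ℕ} (hS : UniformSeg F g ε M)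
    (hg : 0 ≤ g) (hε : 0 < ε) (hθ0 : 0 < θ) (hθ1 : θ < 1) (a : ℕ) (f : K → K) :
    ∀ (L i : ℕ), i + L * (a + 1) ≤ M →
      accExpQ F q (fun _ => ((a : K) + θ) * ε) L f (g + (i : K) * ε)
        = binomExp (q θ) L (fun k => f (g + ((i + L * a + k : ℕ) : K) * ε))
  | 0, i, _ => by simp [accExpQ]
  | L + 1, i, hi => by
    have e1 : (L + 1) * (a + 1) = L * (a + 1) + (a + 1) := Nat.succ_mul L (a + 1)
    have e2 : L * (a + 1) = L * a + L := Nat.mul_succ L a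
    have e3 : (L + 1) * a = L * a + a := Nat.succ_mul L a
    have hia : i + a < M := by omega
    obtain ⟨hd, hu, hp⟩ := const_step_cell hS hε hθ0 hθ1 hia
    have hpq : pUpQ F q (g + (i : K) * ε + ((a : K) + θ) * ε) = q θ := by
      unfold pUpQ; rw [hd, if_pos (by positivity), hp]
    have ihU := accExpQ_const_binomial q hS hg hε hθ0 hθ1 a f L (i + a + 1) (by omega)
    have ihD := accExpQ_const_binomial q hS hg hε hθ0 hθ1 a f L (i + a) (by omega)
    have fU : (fun k => f (g + ((i + a + 1 + L * a + k : ℕ) : K) * ε))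
        = fun k => f (g + ((i + (L + 1) * a + (k + 1) : ℕ) : K) * ε) := by
      funext k; congr 4; omega
    have fD : (fun k => f (g + ((i + a + L * a + k : ℕ) : K) * ε))
        = fun k => f (g + ((i + (L + 1) * a + k : ℕ) : K) * ε) := by
      funext k; congr 4; omega
    show stepQ F q (g + (i : K) * ε + ((a : K) + θ) * ε) (accExpQ F q (fun _ => ((a : K) + θ) * ε) L f) = _
    unfold stepQ
    rw [hpq, hu, hd, ihU, ihD, fU, fD, binomExp_succ]
    ring

/-- **Exact mean:** `E ŝ_L = s + L(a + q θ)ε`. -/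
theorem const_run_mean {F : Finset K} (q : K → K) {g ε θ : K} {M : ℕ} (hS : UniformSeg F g ε M)
    (hg : 0 ≤ g) (hε : 0 < ε) (hθ0 : 0 < θ) (hθ1 : θ < 1) (a : ℕ) {L i : ℕ} (hi : i + L * (a + 1) ≤ M) :
    accExpQ F q (fun _ => ((a : K) + θ) * ε) L (fun y => y) (g + (i : K) * ε)
      = g + (i : K) * ε + L * ((a : K) + q θ) * ε := by
  rw [accExpQ_const_binomial q hS hg hε hθ0 hθ1 a (fun y => y) L i hi]
  have e : (fun k : ℕ => g + ((i + L * a + k : ℕ) : K) * ε)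
      = fun k : ℕ => (g + ((i : K) + L * a) * ε) + (k : K) * ε := by
    funext k; push_cast; ring
  rw [e, binomExp_affine]; ring

/-- **Exact bias, linear in `L`:** `E ŝ_L − (s + L h) = −L(θ − q θ)ε`, `h = (a + θ)ε` the increment. -/
theorem const_run_bias {F : Finset K} (q : K → K) {g ε θ : K} {M : ℕ} (hS : UniformSeg F g ε M)
    (hg : 0 ≤ g) (hε : 0 < ε) (hθ0 : 0 < θ) (hθ1 : θ < 1) (a : ℕ) {L i : ℕ} (hi : i + L * (a + 1) ≤ M) :
    accExpQ F q (fun _ => ((a : K) + θ) * ε) L (fun y => y) (g + (i : K) * ε)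
      - (g + (i : K) * ε + L * (((a : K) + θ) * ε)) = -(L * (θ - q θ) * ε) := by
  rw [const_run_mean q hS hg hε hθ0 hθ1 a hi]; ring

/-- **Exact mean-square error:** `E(ŝ_L − (s + Lh))² = L·p(1−p)ε² + (L(θ − p)ε)²`, `p = q θ` —
variance linear in `L`, squared bias quadratic. -/
theorem const_run_mse {F : Finset K} (q : K → K) {g ε θ : K} {M : ℕ} (hS : UniformSeg F g ε M)
    (hg : 0 ≤ g) (hε : 0 < ε) (hθ0 : 0 < θ) (hθ1 : θ < 1) (a : ℕ) {L i : ℕ} (hi : i + L * (a + 1) ≤ M) :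
    accExpQ F q (fun _ => ((a : K) + θ) * ε) L
        (fun y => (y - (g + (i : K) * ε + L * (((a : K) + θ) * ε))) ^ 2) (g + (i : K) * ε)
      = L * q θ * (1 - q θ) * ε ^ 2 + (L * (θ - q θ) * ε) ^ 2 := by
  rw [accExpQ_const_binomial q hS hg hε hθ0 hθ1 a _ L i hi]
  have e : (fun k : ℕ => (g + ((i + L * a + k : ℕ) : K) * ε - (g + (i : K) * ε + L * (((a : K) + θ) * ε))) ^ 2)
      = fun k : ℕ => ((k : K) * ε - L * θ * ε) ^ 2 := by
    funext k; push_cast; ring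
  rw [e, binomExp_sq_affine]; ring

/-- **Exact SR** (`q = id`): unbiased, `E(ŝ_L − s_L)² = L·θ(1−θ)·ε²` — the i.i.d. Bernoulli variance,
no `√n`-slack. -/
theorem const_run_exactSR {F : Finset K} {g ε θ : K} {M : ℕ} (hS : UniformSeg F g ε M)
    (hg : 0 ≤ g) (hε : 0 < ε) (hθ0 : 0 < θ) (hθ1 : θ < 1) (a : ℕ) {L i : ℕ} (hi : i + L * (a + 1) ≤ M) :
    accExpQ F (fun η => η) (fun _ => ((a : K) + θ) * ε) L (fun y => y) (g + (i : K) * ε)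
        = g + (i : K) * ε + L * (((a : K) + θ) * ε) ∧
      accExpQ F (fun η => η) (fun _ => ((a : K) + θ) * ε) L
        (fun y => (y - (g + (i : K) * ε + L * (((a : K) + θ) * ε))) ^ 2) (g + (i : K) * ε)
        = L * θ * (1 - θ) * ε ^ 2 := by
  refine ⟨?_, ?_⟩
  · rw [const_run_mean (fun η => η) hS hg hε hθ0 hθ1 a hi]; ring
  · rw [const_run_mse (fun η => η) hS hg hε hθ0 hθ1 a hi]; ring

end Generic

section Floor
variable {K : Type*} [Field K] [LinearOrder K] [IsStrictOrderedRing K] [FloorRing K]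

/-- **StochasticA with `N` bits:** bias exactly `−L(θ − ⌊2^Nθ⌋/2^N)ε`, nonpositive and of size
`< L·2^{-N}·ε`; MSE exactly `L p(1−p)ε² + (L(θ−p)ε)²` with `p = probAwayA N θ`. -/
theorem const_run_stochasticA {F : Finset K} (N : ℕ) {g ε θ : K} {M : ℕ} (hS : UniformSeg F g ε M)
    (hg : 0 ≤ g) (hε : 0 < ε) (hθ0 : 0 < θ) (hθ1 : θ < 1) (a : ℕ) {L i : ℕ} (hi : i + L * (a + 1) ≤ M) :
    accExpQ F (probAwayA N) (fun _ => ((a : K) + θ) * ε) L (fun y => y) (g + (i : K) * ε)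
        - (g + (i : K) * ε + L * (((a : K) + θ) * ε)) = -(L * (θ - probAwayA N θ) * ε) ∧
      -(L * (θ - probAwayA N θ) * ε) ≤ 0 ∧
      -(L * ((1 : K) / 2 ^ N) * ε) ≤ -(L * (θ - probAwayA N θ) * ε) ∧
      accExpQ F (probAwayA N) (fun _ => ((a : K) + θ) * ε) L
        (fun y => (y - (g + (i : K) * ε + L * (((a : K) + θ) * ε))) ^ 2) (g + (i : K) * ε)
        = L * probAwayA N θ * (1 - probAwayA N θ) * ε ^ 2 + (L * (θ - probAwayA N θ) * ε) ^ 2 := by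
  have h1 := probAwayA_le N θ
  have h2 := sub_lt_probAwayA N θ
  have hL : (0 : K) ≤ L := Nat.cast_nonneg L
  refine ⟨const_run_bias _ hS hg hε hθ0 hθ1 a hi, ?_, ?_, const_run_mse _ hS hg hε hθ0 hθ1 a hi⟩
  · have : 0 ≤ (L : K) * (θ - probAwayA N θ) * ε := by
      have := mul_nonneg hL (sub_nonneg.mpr h1); positivity
    linarith
  · have : (L : K) * (θ - probAwayA N θ) * ε ≤ L * (1 / 2 ^ N) * ε :=
      mul_le_mul_of_nonneg_right (mul_le_mul_of_nonneg_left (by linarith) hL) hε.le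
    linarith

end Floor

end Summit.Ventures.CertifiedArithmetic.LowPrec.SR.LimitedBits

/-! ### Binary formats: every binade below the top is a uniform segment; a kernel instance -/

namespace Summit.Ventures.CertifiedArithmetic.LowPrec.SR.Formats

open Literature.ComputerArithmetic.ConnollyHighamMary2021
open Literature.ComputerArithmetic.FloatingPoint
open Summit.Ventures.CertifiedArithmetic.LowPrec.SR
open Summit.Ventures.CertifiedArithmetic.LowPrec.SR.LimitedBits
open MiniFloat Finset

/-- The grid point `(2^manBits + i)·2^j·q` of binade `j` (`i ≤ 2^manBits`, `j + 2 ≤ emaxCode`) is a value. -/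
theorem binadePoint_mem_valueSet (φ : Format) {j : ℕ} (hj : j + 2 ≤ φ.emaxCode) {i : ℕ}
    (hi : i ≤ 2 ^ φ.manBits) :
    (2 : ℚ) ^ (φ.manBits + j) * φ.quantum + (i : ℚ) * (2 ^ j * φ.quantum) ∈ valueSet φ := by
  obtain ⟨a, ha⟩ : ∃ a, φ.emaxCode = a + 1 := ⟨φ.emaxCode - 1, by omega⟩
  have hmax := maxScaled_eq_of_emaxCode φ ha
  rcases Nat.lt_or_ge i (2 ^ φ.manBits) with hlt | hge
  · have hr : φ.Representable ((2 ^ φ.manBits + i) * 2 ^ j) := by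
      refine MiniFloat.representable_mul_pow (by rw [pow_succ]; omega) ?_
      rw [hmax]
      calc (2 ^ φ.manBits + i) * 2 ^ j ≤ (2 ^ φ.manBits + 2 ^ φ.manBits) * 2 ^ j :=
            Nat.mul_le_mul_right _ (by omega)
        _ = 2 ^ φ.manBits * 2 ^ (j + 1) := by ring
        _ ≤ 2 ^ φ.manBits * 2 ^ a := Nat.mul_le_mul_left _ (Nat.pow_le_pow_right (by norm_num) (by omega))
        _ ≤ (2 ^ φ.manBits + φ.topMan) * 2 ^ a := Nat.mul_le_mul_right _ (Nat.le_add_right _ _)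
    have h := natMul_mem_of_representable hr
    have e : (((2 ^ φ.manBits + i) * 2 ^ j : ℕ) : ℚ) * φ.quantum
        = (2 : ℚ) ^ (φ.manBits + j) * φ.quantum + (i : ℚ) * (2 ^ j * φ.quantum) := by
      push_cast; ring
    rwa [e] at h
  · have hi' : i = 2 ^ φ.manBits := le_antisymm hi hge
    have hr : φ.Representable (2 ^ φ.manBits * 2 ^ (j + 1)) := by
      refine MiniFloat.representable_mul_pow (Nat.pow_lt_pow_right (by norm_num) (by omega)) ?_
      rw [hmax]
      calc 2 ^ φ.manBits * 2 ^ (j + 1) ≤ 2 ^ φ.manBits * 2 ^ a :=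
            Nat.mul_le_mul_left _ (Nat.pow_le_pow_right (by norm_num) (by omega))
        _ ≤ (2 ^ φ.manBits + φ.topMan) * 2 ^ a := Nat.mul_le_mul_right _ (Nat.le_add_right _ _)
    have h := natMul_mem_of_representable hr
    have e : ((2 ^ φ.manBits * 2 ^ (j + 1) : ℕ) : ℚ) * φ.quantum
        = (2 : ℚ) ^ (φ.manBits + j) * φ.quantum + (i : ℚ) * (2 ^ j * φ.quantum) := by
      rw [hi']; push_cast; ring
    rwa [e] at h

/-- BINADE GAP: a value above the grid point `(2^manBits + i)·2^j·q` is at least the next grid point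
(a significand of at least `2^(manBits+j)` quanta is a multiple of `2^j` quanta). -/
theorem binadeNext_le_of_mem_gt (φ : Format) {j i : ℕ} {v : ℚ} (hv : v ∈ valueSet φ)
    (hlt : (2 : ℚ) ^ (φ.manBits + j) * φ.quantum + (i : ℚ) * (2 ^ j * φ.quantum) < v) :
    (2 : ℚ) ^ (φ.manBits + j) * φ.quantum + ((i + 1 : ℕ) : ℚ) * (2 ^ j * φ.quantum) ≤ v := by
  have hq := φ.quantum_pos
  have h0 : 0 ≤ v := le_of_lt (lt_of_le_of_lt (by positivity) hlt)
  obtain ⟨n, hrep, -, hv', -⟩ := exists_natMul_of_mem hv h0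
  obtain ⟨-, k, l, hk, hnkl⟩ := MiniFloat.representable_iff.mp hrep
  rw [hv'] at hlt ⊢
  have hlt' : (2 ^ φ.manBits + i) * 2 ^ j < n := by
    have : (((2 ^ φ.manBits + i) * 2 ^ j : ℕ) : ℚ) < n := by
      refine lt_of_mul_lt_mul_right ?_ hq.le
      calc (((2 ^ φ.manBits + i) * 2 ^ j : ℕ) : ℚ) * φ.quantum
          = (2 : ℚ) ^ (φ.manBits + j) * φ.quantum + (i : ℚ) * (2 ^ j * φ.quantum) := by push_cast; ring
        _ < n * φ.quantum := hlt
    exact_mod_cast this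
  have hmain : (2 ^ φ.manBits + (i + 1)) * 2 ^ j ≤ n := by
    rcases Nat.lt_or_ge l j with hlj | hlj
    · exfalso
      have h1 : 2 ^ l ≤ 2 ^ (j - 1) := Nat.pow_le_pow_right (by norm_num) (by omega)
      have h2 : n < 2 ^ φ.manBits * 2 ^ j :=
        calc n = k * 2 ^ l := hnkl
          _ ≤ k * 2 ^ (j - 1) := Nat.mul_le_mul_left k h1
          _ < 2 ^ (φ.manBits + 1) * 2 ^ (j - 1) := Nat.mul_lt_mul_of_pos_right hk (by positivity)
          _ = 2 ^ φ.manBits * 2 ^ j := by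
              rw [← pow_add, ← pow_add]; congr 1; omega
      have h3 : 2 ^ φ.manBits * 2 ^ j ≤ (2 ^ φ.manBits + i) * 2 ^ j := Nat.mul_le_mul_right _ (by omega)
      omega
    · have hl : 2 ^ l = 2 ^ (l - j) * 2 ^ j := by rw [← pow_add]; congr 1; omega
      have hn : n = (k * 2 ^ (l - j)) * 2 ^ j := by rw [hnkl, hl, mul_assoc]
      rw [hn] at hlt' ⊢
      have hlt2 : 2 ^ φ.manBits + i < k * 2 ^ (l - j) := Nat.lt_of_mul_lt_mul_right hlt'
      exact Nat.mul_le_mul_right _ hlt2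
  have hc : (((2 ^ φ.manBits + (i + 1)) * 2 ^ j : ℕ) : ℚ) ≤ n := by exact_mod_cast hmain
  calc (2 : ℚ) ^ (φ.manBits + j) * φ.quantum + ((i + 1 : ℕ) : ℚ) * (2 ^ j * φ.quantum)
      = (((2 ^ φ.manBits + (i + 1)) * 2 ^ j : ℕ) : ℚ) * φ.quantum := by push_cast; ring
    _ ≤ n * φ.quantum := mul_le_mul_of_nonneg_right hc hq.le

/-- **Every binade below the top one is a uniform segment** of `2^manBits + 1` points:
`g = 2^(manBits+j)·q`, `ε = 2^j·q`, `M = 2^manBits` (`j + 2 ≤ emaxCode`). -/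
theorem valueSet_binade_uniformSeg (φ : Format) {j : ℕ} (hj : j + 2 ≤ φ.emaxCode) :
    UniformSeg (valueSet φ) ((2 : ℚ) ^ (φ.manBits + j) * φ.quantum) (2 ^ j * φ.quantum)
      (2 ^ φ.manBits) where
  mem i hi := binadePoint_mem_valueSet φ hj hi
  gap i _ y hy := by
    rcases le_or_gt y ((2 : ℚ) ^ (φ.manBits + j) * φ.quantum + (i : ℚ) * (2 ^ j * φ.quantum)) with h | h
    · exact Or.inl h
    · exact Or.inr (binadeNext_le_of_mem_gt φ hy h)

/-- **The law in a format binade** (StochasticA, `N` bits): from the grid point `(2^manBits + i)2^j q`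
with increment `(a + θ)·2^j q`, `0 < θ < 1`, and `i + L(a+1) ≤ 2^manBits`: bias exactly
`−L(θ − A_N θ)·2^j q`, MSE exactly `L p(1−p)(2^j q)² + (L(θ−p)2^j q)²`, `p = A_N θ`. -/
theorem valueSet_const_run_stochasticA (φ : Format) {j : ℕ} (hj : j + 2 ≤ φ.emaxCode) (N a : ℕ)
    {θ : ℚ} (hθ0 : 0 < θ) (hθ1 : θ < 1) {L i : ℕ} (hi : i + L * (a + 1) ≤ 2 ^ φ.manBits) :
    accExpQ (valueSet φ) (probAwayA N) (fun _ => ((a : ℚ) + θ) * (2 ^ j * φ.quantum)) L (fun y => y)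
          ((2 : ℚ) ^ (φ.manBits + j) * φ.quantum + (i : ℚ) * (2 ^ j * φ.quantum))
        - ((2 : ℚ) ^ (φ.manBits + j) * φ.quantum + (i : ℚ) * (2 ^ j * φ.quantum)
            + L * (((a : ℚ) + θ) * (2 ^ j * φ.quantum)))
        = -(L * (θ - probAwayA N θ) * (2 ^ j * φ.quantum)) ∧
      accExpQ (valueSet φ) (probAwayA N) (fun _ => ((a : ℚ) + θ) * (2 ^ j * φ.quantum)) L
          (fun y => (y - ((2 : ℚ) ^ (φ.manBits + j) * φ.quantum + (i : ℚ) * (2 ^ j * φ.quantum)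
            + L * (((a : ℚ) + θ) * (2 ^ j * φ.quantum)))) ^ 2)
          ((2 : ℚ) ^ (φ.manBits + j) * φ.quantum + (i : ℚ) * (2 ^ j * φ.quantum))
        = L * probAwayA N θ * (1 - probAwayA N θ) * (2 ^ j * φ.quantum) ^ 2
          + (L * (θ - probAwayA N θ) * (2 ^ j * φ.quantum)) ^ 2 := by
  have hS := valueSet_binade_uniformSeg φ hj
  have hq := φ.quantum_pos
  have h := const_run_stochasticA N hS (by positivity) (by positivity) hθ0 hθ1 a hi
  exact ⟨h.1, h.2.2.2⟩

/-- KERNEL INSTANCE (E2M1, `manBits = 1`, `quantum = 1/2`; binade `j = 0` is `[1, 2]` with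
`ε = 1/2`, grid `1, 3/2, 2`): increment `3/8 = (0 + 3/4)·(1/2)` from `1`, two steps, StochasticA with
ONE random bit (`A_1(3/4) = 1/2` instead of `3/4`): exact sum `7/4`, mean `3/2` (bias `−1/4 =
−2·(3/4 − 1/2)·(1/2)`), MSE `3/16 = 2·½·½·(1/2)² + (1/4)²` — by the general theorem. -/
theorem e2m1_const_run_one_bit :
    accExpQ (valueSet Format.E2M1) (probAwayA 1) (fun _ => (3 / 8 : ℚ)) 2 (fun y => y) 1 - 7 / 4
        = -(1 / 4 : ℚ) ∧
      accExpQ (valueSet Format.E2M1) (probAwayA 1) (fun _ => (3 / 8 : ℚ)) 2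
          (fun y => (y - 7 / 4) ^ 2) 1 = 3 / 16 := by
  have hA : probAwayA 1 (3 / 4 : ℚ) = 1 / 2 := by norm_num [probAwayA]
  have hq : Format.E2M1.quantum = 1 / 2 := by decide +kernel
  have hm : Format.E2M1.manBits = 1 := rfl
  have h := valueSet_const_run_stochasticA Format.E2M1 (j := 0) (by decide) 1 0 (θ := 3 / 4)
    (by norm_num) (by norm_num) (L := 2) (i := 0) (by decide)
  rw [hq, hm, hA] at h
  norm_num at h
  exact h

end Summit.Ventures.CertifiedArithmetic.LowPrec.SR.Formats
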